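import Mathlib.Algebra.CharP.Lemmas
import Mathlib.Algebra.Polynomial.Coeff
import Mathlib.Data.ZMod.Basic
import Mathlib.Algebra.Field.ZMod
import Mathlib.Data.Nat.Choose.Vandermonde
import Mathlib.Analysis.SpecialFunctions.Pow.Real
import Mathlib.Analysis.SpecialFunctions.Log.Basic
import Mathlib.Analysis.Calculus.Deriv.Pow
import Mathlib.Analysis.Calculus.Deriv.Mul
import Mathlib.Analysis.Calculus.Deriv.Add
import Mathlib.Analysis.Calculus.Deriv.Slope
import Mathlib.GroupTheory.FiniteAbelian.Basic
import Mathlib.GroupTheory.Exponent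
import Literature.Combinatorics.Additive.SliceRankMethod
import HarnessLib

/-!
# Tricolored sum-free sets in abelian groups of bounded exponent (BCCGNSU 2017, Thm. A)

Topic: `Literature/Combinatorics/Additive`. The upper bound of
Blasiak–Church–Cohn–Grochow–Naslund–Sawin–Umans 2017, §4, for tricolored sum-free sets in finite
abelian groups of bounded exponent, PROVED in the qualitative form
`exists_tricoloredSumFree_card_le`: for every `ℓ` there is `δ > 0` such that a tricolored
sum-free set in a finite abelian group `H` of exponent `≤ ℓ` has at most `3 |H|^{1-δ}` elements
(Thm. A as printed has the explicit `δ = ε/m`, `ε = ½ log((2/3)2^{2/3})`, for groups generated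
by elements of order `≤ m`; only the existence of some `δ_ℓ > 0` is needed for Thm. B and proved
here). All ingredients of the printed proof are formalised, with crude constants:

* `natCast_choose_add_pow`, `natCast_choose_pow_sub_one` — periodicity of `C(·, k)` modulo `p`
  with period `q = p^r` for `k < q`, via `(1+X)^{n+q} = (1+X)^n (1+X^q)` in `𝔽_p[X]` (the
  Lucas-theorem step of Prop. 4.15);
* `shiftedIndicator_eq_sum` — **Prop. 4.15**: `[x + y + z + 1 = 0] = Σ_{a+b+c=q-1} C(x,a) C(y,b)
  C(z,c)` in `𝔽_p` for `x, y, z ∈ ℤ/q` (triangle rank of `D_{ℤ/q}` is `≤ q`);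
* `hasSliceRankLE_piZMod` — **Prop. 4.13** (with 4.15) in counting form: the tensor
  `∏ₗ [xₗ + yₗ + zₗ + 1 = 0]` on `((ℤ/q)^κ)³` has slice rank
  `≤ 3 · #{v ∈ {0..q-1}^κ : 3Σv ≤ (q-1)|κ|}` (`LowWeight q κ`);
* `card_lowWeight_mul_pow_le`, `exists_base_lt`, `exists_theta` — the large-deviation estimate of
  **Prop. 4.12** in crude form: `#LowWeight ≤ (θ_q q)^{|κ|}` with some `θ_q < 1` (generating
  function / Markov with a base `v ∈ (0,1)` such that `Σ_{b<q} v^{3b} < q v^{q-1}`, which exists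
  because `g(v) = q v^{q-1} - Σ_{b<q} v^{3b}` has `g(1) = 0`, `g'(1) = -q(q-1)/2 < 0`);
* `IsTricoloredSumFree.card_le_of_addEquiv` — **Thm. 4.14** in counting form for
  `H ≃ (ℤ/q)^κ × G'` (Prop. 4.8 + Prop. 4.2 + Prop. 4.13), over `𝔽_p`;
* `exists_addEquiv_pi_zmod_prod` — the reduction of the proof of Thm. A: a finite abelian group
  of exponent `≤ ℓ` with `|H| > 1` is `≃ (ℤ/q)^κ × G'` for a prime power `2 ≤ q ≤ ℓ` with
  `|H| ≤ q^{|κ| ℓ}` (structure theorem `AddCommGroup.equiv_directSum_zmod_of_finite` + pigeonhole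
  over the at most `ℓ` possible orders of the cyclic factors);
* `exists_tricoloredSumFree_card_le` — **Thm. A** (weak form), assembling the above.

## References

* J. Blasiak, T. Church, H. Cohn, J. A. Grochow, E. Naslund, W. F. Sawin, C. Umans, *On cap sets
  and the group-theoretic approach to matrix multiplication*, Discrete Analysis 2017:3,
  arXiv:1605.06702, §4: road map (p. 10), Prop. 4.2 (p. 11), Lemma 4.7, Prop. 4.8 (p. 13),
  Thm. 4.10 (p. 14), Prop. 4.12, Prop. 4.13 (p. 15), Thm. 4.14, Prop. 4.15 and §4.4 with the
  proofs of Thms. A′ and A (pp. 16–17); Thm. A stated on p. 3. (Page numbers of the held 19-page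
  PDF, `lit read arxiv:1605.06702 --pages …`.)

## Design notes

* Fields: the slice-rank computation is over `𝔽_p = ZMod p` for the prime `p` of the chosen
  homocyclic factor `(ℤ/p^r)^κ`, as in the printed proof of Thm. 4.14.
* We use the shifted tensor `[x + y + z + 1 = 0]` (the paper's `D_{ℤ/q}(x, y, z+1)`), whose
  binomial expansion is cleanest; the shift is absorbed by translating the third family of the
  sum-free set (`IsTricoloredSumFree.card_le_of_addEquiv`).
* Constants are not optimised (`θ_q` is any admissible base, `|H| ≤ q^{|κ|ℓ}` replaces the
  prime-number-theorem count of the paper); the statement proved is accordingly the qualitative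
  `∃ δ > 0`.
-/

namespace Literature.Combinatorics.Additive

open Finset Polynomial

universe u

/-! ### Binomial coefficients modulo `p` and the triangle decomposition of `D_{ℤ/q}` (Prop. 4.15) -/

section Binomial

variable {p : ℕ} [hp : Fact p.Prime]

/-- `C(n + p^r, k) ≡ C(n, k) (mod p)` for `k < p^r`: compare coefficients of `X^k` in
`(1+X)^{n+p^r} = (1+X)^n (1 + X^{p^r})` over `𝔽_p`. [folklore] -/
theorem natCast_choose_add_pow (r n k : ℕ) (hk : k < p ^ r) :
    (((n + p ^ r).choose k : ℕ) : ZMod p) = ((n.choose k : ℕ) : ZMod p) := by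
  have h1 : ((1 + X : (ZMod p)[X]) ^ (n + p ^ r)).coeff k =
      ((1 + X : (ZMod p)[X]) ^ n).coeff k := by
    rw [pow_add, add_pow_char_pow, one_pow, mul_add, mul_one, coeff_add, coeff_mul_X_pow',
      if_neg (not_le.2 hk), add_zero]
  rwa [coeff_one_add_X_pow, coeff_one_add_X_pow] at h1

/-- `C(n + j p^r, k) ≡ C(n, k) (mod p)` for `k < p^r`. [folklore] -/
theorem natCast_choose_add_mul_pow (r n j k : ℕ) (hk : k < p ^ r) :
    (((n + j * p ^ r).choose k : ℕ) : ZMod p) = ((n.choose k : ℕ) : ZMod p) := by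
  induction j with
  | zero => simp
  | succ j ih => rw [Nat.succ_mul, ← add_assoc, natCast_choose_add_pow r _ k hk, ih]

/-- For `q = p^r`: `C(w, q-1) mod p` is `1` if `w ≡ -1 (mod q)` and `0` otherwise (BCCGNSU 2017,
proof of Prop. 4.15, via Lucas' theorem: "`m ≡ m' (mod q) ⟹ C(m,k) ≡ C(m',k) (mod p)`" and
"`C(w, q-1) = 1` if `w = q - 1 ∈ ℤ/qℤ` and `0` otherwise").
[cite: BlasiakChurchCohnGrochowNaslundSawinUmans2017, Prop. 4.15 (proof)] -/
theorem natCast_choose_pow_sub_one (r w : ℕ) :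
    ((w.choose (p ^ r - 1) : ℕ) : ZMod p) = if w % p ^ r = p ^ r - 1 then 1 else 0 := by
  have hq : 0 < p ^ r := pow_pos hp.out.pos r
  conv_lhs => rw [← Nat.mod_add_div w (p ^ r), mul_comm]
  rw [natCast_choose_add_mul_pow r _ _ _ (Nat.sub_lt hq one_pos)]
  split_ifs with h
  · rw [h, Nat.choose_self, Nat.cast_one]
  · rw [Nat.choose_eq_zero_of_lt, Nat.cast_zero]
    have := Nat.mod_lt w hq
    omega

/-- `q ∣ w + 1 ↔ w mod q = q - 1` (`q ≥ 1`). [folklore] -/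
theorem dvd_add_one_iff_mod_eq {q w : ℕ} (hq : 0 < q) : q ∣ w + 1 ↔ w % q = q - 1 := by
  by_cases hq1 : q = 1
  · subst hq1; simp [Nat.mod_one]
  rw [Nat.dvd_iff_mod_eq_zero, Nat.add_mod, Nat.one_mod_eq_one.2 hq1]
  have hlt := Nat.mod_lt w hq
  constructor
  · intro h
    by_contra hne
    have hlt' : w % q + 1 < q := by omega
    rw [Nat.mod_eq_of_lt hlt'] at h
    omega
  · intro h
    rw [h, Nat.sub_add_cancel hq, Nat.mod_self]

/-- **BCCGNSU 2017, Prop. 4.15** ("If `q = p^r` is a prime power, the triangle rank of `D_{ℤ/qℤ}`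
over `𝔽_p` is at most `q`"), as the explicit identity from its proof:
`D_{ℤ/q}(x,y,z+1) = Σ_{a+b+c=q-1} C(x,a) C(y,b) C(z,c)` in `𝔽_p`, for `x,y,z ∈ ℤ/q` read in
`{0,…,q-1}`; here with the sum written as an iterated antidiagonal sum `Σ_{i+c=q-1} Σ_{a+b=i}`.
[cite: BlasiakChurchCohnGrochowNaslundSawinUmans2017, Prop. 4.15] -/
theorem shiftedIndicator_eq_sum {q : ℕ} [NeZero q] (r : ℕ) (hq : q = p ^ r) (x y z : ZMod q) :
    (if x + y + z + 1 = 0 then (1 : ZMod p) else 0) =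
      ∑ ic ∈ antidiagonal (q - 1), ∑ ab ∈ antidiagonal ic.1,
        ((x.val.choose ab.1 : ℕ) : ZMod p) * ((y.val.choose ab.2 : ℕ) : ZMod p) *
          ((z.val.choose ic.2 : ℕ) : ZMod p) := by
  have hV : (((x.val + y.val + z.val).choose (q - 1) : ℕ) : ZMod p) =
      ∑ ic ∈ antidiagonal (q - 1), ∑ ab ∈ antidiagonal ic.1,
        ((x.val.choose ab.1 : ℕ) : ZMod p) * ((y.val.choose ab.2 : ℕ) : ZMod p) *
          ((z.val.choose ic.2 : ℕ) : ZMod p) := by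
    rw [Nat.add_choose_eq, Nat.cast_sum]
    refine Finset.sum_congr rfl fun ic _ => ?_
    rw [Nat.add_choose_eq, Finset.sum_mul, Nat.cast_sum]
    refine Finset.sum_congr rfl fun ab _ => ?_
    push_cast
    ring
  have key : x + y + z + 1 = 0 ↔ (x.val + y.val + z.val) % q = q - 1 := by
    rw [← dvd_add_one_iff_mod_eq (NeZero.pos q), ← ZMod.natCast_eq_zero_iff]
    push_cast
    rw [ZMod.natCast_zmod_val, ZMod.natCast_zmod_val, ZMod.natCast_zmod_val]
  rw [← hV, if_congr key rfl rfl]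
  subst hq
  exact (natCast_choose_pow_sub_one r _).symm

end Binomial

/-! ### Slice rank of `D_{(ℤ/q)^κ}` over `𝔽_p` (BCCGNSU 2017, Prop. 4.13 / Thm. 4.14, counting
form) -/

section Power

variable {p : ℕ} [hp : Fact p.Prime]

/-- The vectors `v ∈ {0,…,q-1}^κ` of weight `Σ v ≤ (q-1)|κ|/3` ("the number of tuples
`a ∈ {0,…,k-1}^n` with `Σ aᵢ ≤ (k-1)n/3`" of BCCGNSU 2017, proof of Prop. 4.13).
[cite: BlasiakChurchCohnGrochowNaslundSawinUmans2017, Prop. 4.13 (proof)] -/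
abbrev LowWeight (q : ℕ) (κ : Type u) [Fintype κ] : Type u :=
  {v : κ → Fin q // 3 * ∑ l, (v l : ℕ) ≤ (q - 1) * Fintype.card κ}

/-- **Slice rank of `D_{(ℤ/q)^n}`** (BCCGNSU 2017, Prop. 4.13 with Prop. 4.15, before the
large-deviation estimate: "the relevant estimate in this case is the number of tuples
`a ∈ {0,…,k-1}^n` with `Σᵢ aᵢ ≤ (k-1)n/3`"): for `q = p^r`, the tensor
`∏_l [x_l + y_l + z_l + 1 = 0]` on `((ℤ/q)^κ)³` over `𝔽_p` has a slice decomposition with at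
most `3 · #{v ∈ {0,…,q-1}^κ : 3 Σ v ≤ (q-1)|κ|}` slices.
[cite: BlasiakChurchCohnGrochowNaslundSawinUmans2017, Prop. 4.13] -/
theorem hasSliceRankLE_piZMod {q : ℕ} [NeZero q] (r : ℕ) (hq : q = p ^ r) (κ : Type u) [Fintype κ]
    [DecidableEq κ] :
    HasSliceRankLE
      (fun x y z : κ → ZMod q => ∏ l, (if x l + y l + z l + 1 = 0 then (1 : ZMod p) else 0))
      (3 * Fintype.card (LowWeight q κ)) := by
  classical
  set S : Finset (Σ _ : ℕ × ℕ, ℕ × ℕ) := (antidiagonal (q - 1)).sigma fun ic => antidiagonal ic.1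
    with hS
  have hmem : ∀ w ∈ S, w.2.1 + w.2.2 + w.1.2 = q - 1 := by
    rintro ⟨⟨i, c⟩, ⟨a, b⟩⟩ hw
    simp only [hS, mem_sigma, mem_antidiagonal] at hw ⊢
    omega
  set n := Fintype.card κ with hn
  have h1 : ∀ x y z : ZMod q, (if x + y + z + 1 = 0 then (1 : ZMod p) else 0) =
      ∑ w : S, ((x.val.choose w.1.2.1 : ℕ) : ZMod p) * ((y.val.choose w.1.2.2 : ℕ) : ZMod p) *
        ((z.val.choose w.1.1.2 : ℕ) : ZMod p) := by
    intro x y z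
    rw [shiftedIndicator_eq_sum r hq, Finset.sum_sigma']
    exact (Finset.sum_coe_sort S fun w => ((x.val.choose w.2.1 : ℕ) : ZMod p) *
      ((y.val.choose w.2.2 : ℕ) : ZMod p) * ((z.val.choose w.1.2 : ℕ) : ZMod p)).symm
  -- the rank-one decomposition of the product tensor, indexed by `κ → S`
  set Fx : (κ → S) → (κ → ZMod q) → ZMod p :=
    fun ω x => ∏ l, (((x l).val.choose (ω l).1.2.1 : ℕ) : ZMod p) with hFx
  set Fy : (κ → S) → (κ → ZMod q) → ZMod p :=
    fun ω y => ∏ l, (((y l).val.choose (ω l).1.2.2 : ℕ) : ZMod p) with hFy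
  set Fz : (κ → S) → (κ → ZMod q) → ZMod p :=
    fun ω z => ∏ l, (((z l).val.choose (ω l).1.1.2 : ℕ) : ZMod p) with hFz
  have hD : ∀ x y z : κ → ZMod q, (∏ l, if x l + y l + z l + 1 = 0 then (1 : ZMod p) else 0) =
      ∑ ω : κ → S, Fx ω x * Fy ω y * Fz ω z := by
    intro x y z
    simp_rw [h1]
    rw [Fintype.prod_sum]
    refine Finset.sum_congr rfl fun ω _ => ?_
    rw [hFx, hFy, hFz]
    simp only
    rw [← Finset.prod_mul_distrib, ← Finset.prod_mul_distrib]
  -- weights and classes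
  set A : (κ → S) → κ → ℕ := fun ω l => (ω l).1.2.1 with hA
  set B : (κ → S) → κ → ℕ := fun ω l => (ω l).1.2.2 with hB
  set C : (κ → S) → κ → ℕ := fun ω l => (ω l).1.1.2 with hC
  have hABC : ∀ ω, (∑ l, A ω l) + (∑ l, B ω l) + (∑ l, C ω l) = (q - 1) * n := by
    intro ω
    rw [← Finset.sum_add_distrib, ← Finset.sum_add_distrib,
      Finset.sum_congr rfl fun l _ => hmem _ (ω l).2, Finset.sum_const, card_univ, smul_eq_mul,
      mul_comm]
  have hlt : ∀ (ω : κ → S) (l : κ), A ω l < q ∧ B ω l < q ∧ C ω l < q := by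
    intro ω l
    have h := hmem _ (ω l).2
    have hq1 : 1 ≤ q := NeZero.one_le
    simp only [hA, hB, hC]
    omega
  set c : (κ → S) → Fin 3 := fun ω =>
    if 3 * ∑ l, A ω l ≤ (q - 1) * n then 0 else if 3 * ∑ l, B ω l ≤ (q - 1) * n then 1 else 2
    with hc
  set v0 : LowWeight q κ := ⟨fun _ => 0, by simp⟩ with hv0
  set πx : (κ → S) → LowWeight q κ := fun ω =>
    if h : 3 * ∑ l, A ω l ≤ (q - 1) * n then ⟨fun l => ⟨A ω l, (hlt ω l).1⟩, by simpa using h⟩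
    else v0 with hπx
  set πy : (κ → S) → LowWeight q κ := fun ω =>
    if h : 3 * ∑ l, B ω l ≤ (q - 1) * n then ⟨fun l => ⟨B ω l, (hlt ω l).2.1⟩, by simpa using h⟩
    else v0 with hπy
  set πz : (κ → S) → LowWeight q κ := fun ω =>
    if h : 3 * ∑ l, C ω l ≤ (q - 1) * n then ⟨fun l => ⟨C ω l, (hlt ω l).2.2⟩, by simpa using h⟩
    else v0 with hπz
  set φ : LowWeight q κ → (κ → ZMod q) → ZMod p :=
    fun v x => ∏ l, (((x l).val.choose (v.1 l : ℕ) : ℕ) : ZMod p) with hφ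
  have h3 : Fintype.card (LowWeight q κ) + Fintype.card (LowWeight q κ) +
      Fintype.card (LowWeight q κ) = 3 * Fintype.card (LowWeight q κ) := by ring
  rw [← h3]
  refine hasSliceRankLE_of_cover _ Fx Fy Fz hD c πx φ ?_ πy φ ?_ πz φ ?_
  · intro ω h0
    have hAω : 3 * ∑ l, A ω l ≤ (q - 1) * n := by
      by_contra hAω
      simp only [hc, if_neg hAω] at h0
      split_ifs at h0 with hBω <;> exact absurd h0 (by decide)
    simp only [hπx, dif_pos hAω]
    rfl
  · intro ω h1'
    have hAω : ¬ 3 * ∑ l, A ω l ≤ (q - 1) * n := by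
      intro hAω
      simp only [hc, if_pos hAω] at h1'
      exact absurd h1' (by decide)
    have hBω : 3 * ∑ l, B ω l ≤ (q - 1) * n := by
      by_contra hBω
      simp only [hc, if_neg hAω, if_neg hBω] at h1'
      exact absurd h1' (by decide)
    simp only [hπy, dif_pos hBω]
    rfl
  · intro ω h2
    have hAω : ¬ 3 * ∑ l, A ω l ≤ (q - 1) * n := by
      intro hAω
      simp only [hc, if_pos hAω] at h2
      exact absurd h2 (by decide)
    have hBω : ¬ 3 * ∑ l, B ω l ≤ (q - 1) * n := by
      intro hBω
      simp only [hc, if_neg hAω, if_pos hBω] at h2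
      exact absurd h2 (by decide)
    have hCω : 3 * ∑ l, C ω l ≤ (q - 1) * n := by
      have h := hABC ω
      omega
    simp only [hπz, dif_pos hCω]
    rfl

/-- Large-deviation count by the generating function ("Markov's inequality" step of BCCGNSU 2017,
Prop. 4.12): for `0 ≤ v ≤ 1`,
`#{w ∈ {0,…,q-1}^n : 3 Σ w ≤ (q-1) n} · v^{(q-1)n} ≤ (Σ_{b<q} v^{3b})^n`.
[cite: BlasiakChurchCohnGrochowNaslundSawinUmans2017, Prop. 4.12 (proof)] -/
theorem card_lowWeight_mul_pow_le (q : ℕ) (κ : Type u) [Fintype κ] [DecidableEq κ] (v : ℝ)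
    (hv0 : 0 ≤ v)
    (hv1 : v ≤ 1) :
    (Fintype.card (LowWeight q κ) : ℝ) * v ^ ((q - 1) * Fintype.card κ) ≤
      (∑ b ∈ range q, v ^ (3 * b)) ^ Fintype.card κ := by
  classical
  set n := Fintype.card κ with hn
  have hcard0 : Fintype.card (LowWeight q κ) =
      ((univ : Finset (κ → Fin q)).filter (fun w => 3 * ∑ l, (w l : ℕ) ≤ (q - 1) * n)).card :=
    Fintype.card_subtype _
  have hcard : (Fintype.card (LowWeight q κ) : ℝ) =
      ∑ w ∈ (univ : Finset (κ → Fin q)).filter (fun w => 3 * ∑ l, (w l : ℕ) ≤ (q - 1) * n), 1 := by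
    rw [Finset.sum_const, nsmul_eq_mul, mul_one, hcard0]
  rw [hcard, Finset.sum_mul]
  calc ∑ w ∈ (univ : Finset (κ → Fin q)).filter (fun w => 3 * ∑ l, (w l : ℕ) ≤ (q - 1) * n),
        (1 : ℝ) * v ^ ((q - 1) * n)
      ≤ ∑ w ∈ (univ : Finset (κ → Fin q)).filter (fun w => 3 * ∑ l, (w l : ℕ) ≤ (q - 1) * n),
        v ^ (3 * ∑ l, (w l : ℕ)) := by
        refine Finset.sum_le_sum fun w hw => ?_
        rw [one_mul]
        exact pow_le_pow_of_le_one hv0 hv1 (mem_filter.1 hw).2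
    _ ≤ ∑ w : κ → Fin q, v ^ (3 * ∑ l, (w l : ℕ)) :=
        Finset.sum_le_sum_of_subset_of_nonneg (Finset.filter_subset _ _)
          fun w _ _ => pow_nonneg hv0 _
    _ = ∑ w : κ → Fin q, ∏ l, v ^ (3 * (w l : ℕ)) := by
        refine Finset.sum_congr rfl fun w _ => ?_
        rw [Finset.mul_sum, Finset.prod_pow_eq_pow_sum]
    _ = ∏ _l : κ, ∑ b : Fin q, v ^ (3 * (b : ℕ)) :=
        (Fintype.prod_sum fun (_ : κ) (b : Fin q) => v ^ (3 * (b : ℕ))).symm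
    _ = (∑ b ∈ range q, v ^ (3 * b)) ^ n := by
        rw [Finset.prod_const, card_univ, ← hn, Fin.sum_univ_eq_sum_range (fun b => v ^ (3 * b))]

/-- The base of the exponential saving: for `q ≥ 2` there is `v ∈ (0,1)` with
`Σ_{b<q} v^{3b} < q v^{q-1}` (the function `g(v) = q v^{q-1} - Σ_{b<q} v^{3b}` vanishes at `1`
and has derivative `-q(q-1)/2 < 0` there; this is the positivity of the rate function
`I(q-1, 1/3)` of BCCGNSU 2017, Prop. 4.12, in the crude form needed here).
[cite: BlasiakChurchCohnGrochowNaslundSawinUmans2017, Prop. 4.12] -/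
theorem exists_base_lt (q : ℕ) (hq : 2 ≤ q) :
    ∃ v : ℝ, 0 < v ∧ v < 1 ∧ ∑ b ∈ range q, v ^ (3 * b) < q * v ^ (q - 1) := by
  set g : ℝ → ℝ := fun v => (q : ℝ) * v ^ (q - 1) - ∑ b ∈ range q, v ^ (3 * b) with hg
  have hg1 : g 1 = 0 := by simp [hg]
  set D : ℝ := (q : ℝ) * ((q - 1 : ℕ) : ℝ) - ∑ b ∈ range q, ((3 * b : ℕ) : ℝ) with hD
  have hderiv : HasDerivAt g D 1 := by
    have h1 : HasDerivAt (fun v : ℝ => (q : ℝ) * v ^ (q - 1))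
        ((q : ℝ) * (((q - 1 : ℕ) : ℝ) * (1 : ℝ) ^ (q - 1 - 1))) 1 :=
      HasDerivAt.const_mul (q : ℝ) (hasDerivAt_pow (q - 1) (1 : ℝ))
    have h2 : HasDerivAt (fun v : ℝ => ∑ b ∈ range q, v ^ (3 * b))
        (∑ b ∈ range q, ((3 * b : ℕ) : ℝ) * (1 : ℝ) ^ (3 * b - 1)) 1 :=
      HasDerivAt.fun_sum fun b _ => hasDerivAt_pow (3 * b) (1 : ℝ)
    have h := HasDerivAt.sub h1 h2
    simp only [one_pow, mul_one] at h
    exact h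
  have hDneg : D < 0 := by
    have hcast : ((q - 1 : ℕ) : ℝ) = (q : ℝ) - 1 := by
      rw [Nat.cast_sub (by omega : 1 ≤ q), Nat.cast_one]
    have hsum2 : (∑ b ∈ range q, (b : ℝ)) * 2 = (q : ℝ) * ((q : ℝ) - 1) := by
      have h := congrArg (Nat.cast (R := ℝ)) (Finset.sum_range_id_mul_two q)
      rw [Nat.cast_mul, Nat.cast_mul, Nat.cast_sum, hcast, Nat.cast_ofNat] at h
      exact h
    have hD' : D = (q : ℝ) * ((q : ℝ) - 1) - 3 * ∑ b ∈ range q, (b : ℝ) := by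
      rw [hD, hcast, Finset.mul_sum]
      congr 1
      refine Finset.sum_congr rfl fun b _ => ?_
      push_cast
      ring
    have hq2 : (2 : ℝ) ≤ (q : ℝ) := by exact_mod_cast hq
    have hP : (2 : ℝ) ≤ (q : ℝ) * ((q : ℝ) - 1) := by nlinarith
    rw [hD']
    linarith
  -- slope of `g` at `1` is eventually negative from the left
  have hev : ∀ᶠ v in nhdsWithin (1 : ℝ) (Set.Iio 1), slope g 1 v < 0 := by
    have ht : Filter.Tendsto (slope g 1) (nhdsWithin (1 : ℝ) {1}ᶜ) (nhds D) :=
      hasDerivAt_iff_tendsto_slope.1 hderiv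
    have h := ht.eventually (eventually_lt_nhds hDneg)
    exact h.filter_mono (nhdsWithin_mono _ fun x hx => ne_of_lt hx)
  have hev2 : ∀ᶠ v in nhdsWithin (1 : ℝ) (Set.Iio 1), v ∈ Set.Ioo (1 / 2 : ℝ) 1 :=
    Ioo_mem_nhdsLT (by norm_num)
  obtain ⟨v, hv1, hv2⟩ := (hev.and hev2).exists
  refine ⟨v, by linarith [hv2.1], hv2.2, ?_⟩
  rw [slope_def_field, hg1, sub_zero] at hv1
  have hden : v - 1 < 0 := by linarith [hv2.2]
  have hgv : 0 < g v := by
    rcases div_neg_iff.1 hv1 with ⟨h, _⟩ | ⟨_, h⟩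
    · exact h
    · linarith
  simp only [hg] at hgv
  linarith

end Power

/-! ### Theorem 4.14 (counting form) for `H ≃ (ℤ/q)^κ × G'` -/

section Product

variable {p : ℕ} [hp : Fact p.Prime]

universe v w w'

/-- **BCCGNSU 2017, Thm. 4.14** (counting form, before the estimate of the number of low-weight
vectors): if `H ≃ (ℤ/q)^κ × G'` with `q = p^r`, then every tricolored sum-free set in `H` has
size at most `3 · #{v ∈ {0,…,q-1}^κ : 3 Σ v ≤ (q-1)|κ|} · |G'|` (Prop. 4.8 + Prop. 4.2 +
Prop. 4.13/4.15: `|M| ≤ slicerank D_H ≤ slicerank D_{(ℤ/q)^κ} · |G'|`).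
[cite: BlasiakChurchCohnGrochowNaslundSawinUmans2017, Thm. 4.14] -/
theorem IsTricoloredSumFree.card_le_of_addEquiv {q : ℕ} [NeZero q] (r : ℕ) (hq : q = p ^ r)
    {κ : Type u} [Fintype κ] [DecidableEq κ] {G' : Type v} [AddCommGroup G'] [Fintype G']
    [DecidableEq G'] {H : Type w} [AddCommGroup H] (e : H ≃+ (κ → ZMod q) × G')
    {ι : Type w'} [Fintype ι] {s t u : ι → H} (h : IsTricoloredSumFree s t u) :
    Fintype.card ι ≤ 3 * Fintype.card (LowWeight q κ) * Fintype.card G' := by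
  classical
  have hD := (hasSliceRankLE_piZMod (p := p) r hq κ).mul_tensor
    (fun x y z : G' => if x + y + z = 0 then (1 : ZMod p) else 0)
  refine hD.card_le_of_matching (fun i => e (s i)) (fun j => e (t j))
    (fun k => e (u k) + (fun _ => -1, 0)) fun i j k => ?_
  have key : s i + t j + u k = 0 ↔
      (∀ l, (e (s i)).1 l + (e (t j)).1 l + ((e (u k)).1 l + -1) + 1 = 0) ∧
        ((e (s i)).2 + (e (t j)).2 + ((e (u k)).2 + 0) = 0) := by
    rw [← e.map_eq_zero_iff, map_add, map_add, Prod.ext_iff, funext_iff]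
    simp only [Prod.fst_add, Prod.snd_add, Pi.add_apply, Prod.fst_zero, Prod.snd_zero,
      Pi.zero_apply, add_zero]
    refine and_congr (forall_congr' fun l => ?_) Iff.rfl
    constructor <;> intro h' <;> rw [← h'] <;> abel
  rw [← h i j k, key]
  simp only [Prod.fst_add, Prod.snd_add, Pi.add_apply, Finset.prod_boole, Finset.mem_univ,
    true_implies, mul_ne_zero_iff, Ne, ite_eq_right_iff, one_ne_zero, imp_false, not_not]

end Product

/-! ### Structure: a bounded-exponent group has a large homocyclic factor -/

section Structure

universe w

/-- A finite abelian group `H` of exponent at most `ℓ` with `|H| > 1` is isomorphic to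
`(ℤ/q)^κ × G'` for a prime power `2 ≤ q = p^r ≤ ℓ` with `|H| ≤ q^{|κ| ℓ}` (structure theorem of
finite abelian groups, `H ≃ ⨁ᵢ ℤ/qᵢ` with prime powers `qᵢ ∣ exp H`, grouped by the value of
`qᵢ`; the value `q` maximising `q^{#{i : qᵢ = q}}` works since there are at most `ℓ` values).
This is the reduction "such a group must decompose as `H ≅ G × K` where `G ≅ (ℤ/p^k ℤ)^n` and
`|G| ≥ |H|^c`" of BCCGNSU 2017, §4 (road map) and the proof of Thm. A, with the crude constant
`c = 1/ℓ`. [cite: BlasiakChurchCohnGrochowNaslundSawinUmans2017, Thm. A (proof)] -/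
theorem exists_addEquiv_pi_zmod_prod (ℓ : ℕ) (H : Type w) [AddCommGroup H] [Finite H]
    (hexp : AddMonoid.exponent H ≤ ℓ) (hH : 1 < Nat.card H) :
    ∃ (p : ℕ) (_ : Fact p.Prime) (r : ℕ) (κ : Type) (_ : Fintype κ) (_ : DecidableEq κ)
      (G' : Type) (_ : AddCommGroup G') (_ : Fintype G') (_ : DecidableEq G'),
      2 ≤ p ^ r ∧ p ^ r ≤ ℓ ∧ Nat.card H ≤ (p ^ r) ^ (Fintype.card κ * ℓ) ∧
        Nonempty (H ≃+ (κ → ZMod (p ^ r)) × G') := by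
  classical
  obtain ⟨ι, _, pr, hpr, e, ⟨f⟩⟩ := AddCommGroup.equiv_directSum_zmod_of_finite H
  set Q : ι → ℕ := fun i => pr i ^ e i with hQ
  have hQpos : ∀ i, 0 < Q i := fun i => pow_pos (hpr i).pos _
  haveI : ∀ i, NeZero (Q i) := fun i => ⟨(hQpos i).ne'⟩
  let g : H ≃+ (Π i, ZMod (Q i)) := f.trans (DirectSum.addEquivProd _)
  have hcard : Nat.card H = ∏ i, Q i := by
    rw [Nat.card_congr g.toEquiv, Nat.card_pi]
    simp only [Nat.card_zmod, hQ]
  -- every `Q i` divides the exponent, hence is at most `ℓ`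
  have hQle : ∀ i, Q i ≤ ℓ := by
    intro i
    have hpos : 0 < AddMonoid.exponent H :=
      AddMonoid.exponent_pos.2 AddMonoid.ExponentExists.of_finite
    have hdvd : Q i ∣ AddMonoid.exponent H := by
      have h1 := AddMonoid.exponent_nsmul_eq_zero (g.symm (Pi.single i (1 : ZMod (Q i))))
      have h2 := congrArg g h1
      rw [map_nsmul, AddEquiv.apply_symm_apply, map_zero] at h2
      have h3 := congr_fun h2 i
      simp only [Pi.smul_apply, Pi.single_eq_same, Pi.zero_apply, nsmul_eq_mul, mul_one] at h3
      exact (ZMod.natCast_eq_zero_iff _ _).1 h3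
    exact (Nat.le_of_dvd hpos hdvd).trans hexp
  -- values of `Q` and their multiplicities
  set vals : Finset ℕ := univ.image Q with hvals
  set mult : ℕ → ℕ := fun v => (univ.filter fun i => Q i = v).card with hmult
  have hprod : ∏ i, Q i = ∏ v ∈ vals, v ^ mult v := Finset.prod_comp (fun v : ℕ => v) Q
  have hvalsne : vals.Nonempty := by
    by_contra hv
    rw [Finset.not_nonempty_iff_eq_empty, hvals, Finset.image_eq_empty,
      Finset.univ_eq_empty_iff] at hv
    rw [hcard, Fintype.prod_empty] at hH
    exact lt_irrefl _ hH
  obtain ⟨qv, hqv, hmax⟩ := vals.exists_max_image (fun v => v ^ mult v) hvalsne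
  obtain ⟨i₀, -, hi₀⟩ := Finset.mem_image.1 hqv
  have hqv1 : 1 ≤ qv := hi₀ ▸ hQpos i₀
  have hle1 : Nat.card H ≤ (qv ^ mult qv) ^ vals.card := by
    rw [hcard, hprod]
    exact Finset.prod_le_pow_card _ _ _ fun v hv => hmax v hv
  have hvalscard : vals.card ≤ ℓ := by
    have hsub : vals ⊆ Finset.Icc 1 ℓ := by
      intro v hv
      obtain ⟨i, -, rfl⟩ := Finset.mem_image.1 hv
      exact Finset.mem_Icc.2 ⟨hQpos i, hQle i⟩
    exact (Finset.card_le_card hsub).trans (by simp)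
  have hle2 : Nat.card H ≤ (qv ^ mult qv) ^ ℓ :=
    hle1.trans (Nat.pow_le_pow_right (Nat.one_le_pow _ _ hqv1) hvalscard)
  have hqv2 : 2 ≤ qv := by
    by_contra hlt
    have h1 : qv = 1 := by omega
    rw [h1, one_pow, one_pow] at hle2
    omega
  -- the splitting
  set P : ι → Prop := fun i => Q i = qv with hP
  let e₁ : (Π i, ZMod (Q i)) ≃+
      (Π i : {i // P i}, ZMod (Q i.1)) × (Π i : {i // ¬ P i}, ZMod (Q i.1)) :=
    (RingEquiv.piEquivPiSubtypeProd P (fun i => ZMod (Q i))).toAddEquiv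
  have hcongr : ∀ i : {i // P i}, Q i.1 = pr i₀ ^ e i₀ := fun i => i.2.trans hi₀.symm
  let e₂ : (Π i : {i // P i}, ZMod (Q i.1)) ≃+ ({i // P i} → ZMod (pr i₀ ^ e i₀)) :=
    AddEquiv.piCongrRight fun i => (ZMod.ringEquivCongr (hcongr i)).toAddEquiv
  refine ⟨pr i₀, ⟨hpr i₀⟩, e i₀, {i // P i}, inferInstance, inferInstance,
    (Π i : {i // ¬ P i}, ZMod (Q i.1)), inferInstance, inferInstance, inferInstance,
    ?_, ?_, ?_, ⟨g.trans (e₁.trans (AddEquiv.prodCongr e₂ (AddEquiv.refl _)))⟩⟩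
  · change 2 ≤ Q i₀
    rw [hi₀]; exact hqv2
  · exact hQle i₀
  · change Nat.card H ≤ Q i₀ ^ (Fintype.card {i // P i} * ℓ)
    rw [hi₀, pow_mul, Fintype.card_subtype]
    exact hle2

end Structure

/-! ### Theorem A (weak form): tricolored sum-free sets in groups of exponent `≤ ℓ` -/

section TheoremA

universe w w'

/-- Exponential smallness of the number of low-weight vectors, packaged: for every `q` there is
`θ_q > 0`, and for `q ≥ 2` moreover `θ_q < 1` with `#{v ∈ {0,…,q-1}^n : 3Σv ≤ (q-1)n} ≤ (θ_q q)^n`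
for all `n` (BCCGNSU 2017, Prop. 4.12 in crude form).
[cite: BlasiakChurchCohnGrochowNaslundSawinUmans2017, Prop. 4.12] -/
theorem exists_theta (q : ℕ) : ∃ θ : ℝ, 0 < θ ∧ (2 ≤ q → θ < 1 ∧
    ∀ (κ : Type) [Fintype κ] [DecidableEq κ],
      (Fintype.card (LowWeight q κ) : ℝ) ≤ (θ * q) ^ Fintype.card κ) := by
  by_cases hq : 2 ≤ q
  · obtain ⟨v, hv0, hv1, hlt⟩ := exists_base_lt q hq
    have hq0 : (0 : ℝ) < q := by exact_mod_cast (show 0 < q by omega)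
    have hden : 0 < (q : ℝ) * v ^ (q - 1) := mul_pos hq0 (pow_pos hv0 _)
    have hnum : 0 < ∑ b ∈ range q, v ^ (3 * b) :=
      Finset.sum_pos (fun b _ => pow_pos hv0 _) ⟨0, by simp; omega⟩
    refine ⟨(∑ b ∈ range q, v ^ (3 * b)) / (q * v ^ (q - 1)), div_pos hnum hden, fun _ =>
      ⟨(div_lt_one hden).2 hlt, fun κ _ _ => ?_⟩⟩
    have h := card_lowWeight_mul_pow_le q κ v hv0.le hv1.le
    have hvpow : 0 < v ^ ((q - 1) * Fintype.card κ) := pow_pos hv0 _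
    rw [← le_div_iff₀ hvpow] at h
    refine h.trans (le_of_eq ?_)
    rw [show (∑ b ∈ range q, v ^ (3 * b)) / (q * v ^ (q - 1)) * q =
      (∑ b ∈ range q, v ^ (3 * b)) / v ^ (q - 1) by field_simp, div_pow, ← pow_mul]
  · exact ⟨1 / 2, by norm_num, fun h => absurd h hq⟩

/-- A tricolored sum-free set in a trivial group has at most one element. [folklore] -/
theorem IsTricoloredSumFree.card_le_one_of_subsingleton {H : Type w} [AddCommGroup H]
    [Subsingleton H] {ι : Type w'} [Fintype ι] {s t u : ι → H} (h : IsTricoloredSumFree s t u) :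
    Fintype.card ι ≤ 1 :=
  Fintype.card_le_one_iff_subsingleton.2 ⟨fun i j => ((h i j j).1 (Subsingleton.elim _ _)).1⟩

/-- **BCCGNSU 2017, Thm. A (weak form)**. Thm. A as printed: "There exists an absolute constant
`ε = ½ log((2/3)2^{2/3}) = 0.02831…` such that if `H` is an abelian group generated by elements
of order at most `m`, then every tricolored sum-free set in `H` has size at most
`3 · |H|^{1-ε/m}`." PROVED here in the qualitative form that suffices for Thm. B: for every `ℓ`
there is `δ > 0` such that every tricolored sum-free set in a finite abelian group of exponent at
most `ℓ` has size at most `3 |H|^{1-δ}` (the constant obtained is `δ = min_{2 ≤ q ≤ ℓ}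
log(1/θ_q) / (ℓ log q)` with the crude `θ_q` of `exists_theta`, not the printed one).
[cite: BlasiakChurchCohnGrochowNaslundSawinUmans2017, Thm. A] -/
theorem exists_tricoloredSumFree_card_le (ℓ : ℕ) :
    ∃ δ : ℝ, 0 < δ ∧ ∀ (H : Type w) [AddCommGroup H] [Fintype H], AddMonoid.exponent H ≤ ℓ →
      ∀ (ι : Type w') [Fintype ι] (s t u : ι → H), IsTricoloredSumFree s t u →
        (Fintype.card ι : ℝ) ≤ 3 * (Fintype.card H : ℝ) ^ (1 - δ) := by
  classical
  choose θ hθpos hθ using exists_theta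
  -- the trivial-group estimate, used twice
  have htriv : ∀ (δ : ℝ) (H : Type w) [AddCommGroup H] [Fintype H], Fintype.card H ≤ 1 →
      ∀ (ι : Type w') [Fintype ι] (s t u : ι → H), IsTricoloredSumFree s t u →
        (Fintype.card ι : ℝ) ≤ 3 * (Fintype.card H : ℝ) ^ (1 - δ) := by
    intro δ H _ _ hH ι _ s t u h
    haveI : Subsingleton H := Fintype.card_le_one_iff_subsingleton.1 hH
    have h1 : Fintype.card H = 1 := le_antisymm hH Fintype.card_pos
    have h2 : (Fintype.card ι : ℝ) ≤ 1 := by exact_mod_cast h.card_le_one_of_subsingleton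
    rw [h1, Nat.cast_one, Real.one_rpow]
    linarith
  by_cases hℓ : ℓ < 2
  · refine ⟨1, one_pos, fun H _ _ hexp ι _ s t u h => htriv 1 H ?_ ι s t u h⟩
    have hpos : 0 < AddMonoid.exponent H :=
      AddMonoid.exponent_pos.2 AddMonoid.ExponentExists.of_finite
    have h1 : AddMonoid.exponent H = 1 := by omega
    haveI := AddMonoid.exp_eq_one_iff.1 h1
    exact Fintype.card_le_one_iff_subsingleton.2 ‹_›
  push Not at hℓ
  set δq : ℕ → ℝ := fun q => -Real.log (θ q) / (ℓ * Real.log q) with hδq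
  have hne : (Finset.Icc 2 ℓ).Nonempty := ⟨2, Finset.mem_Icc.2 ⟨le_rfl, hℓ⟩⟩
  have hδqpos : ∀ q ∈ Finset.Icc 2 ℓ, 0 < δq q := by
    intro q hq
    have hq2 : 2 ≤ q := (Finset.mem_Icc.1 hq).1
    have hlogθ : Real.log (θ q) < 0 := Real.log_neg (hθpos q) (hθ q hq2).1
    have hlogq : 0 < Real.log q := Real.log_pos (by exact_mod_cast hq2)
    have hℓpos : (0 : ℝ) < ℓ := by exact_mod_cast (show 0 < ℓ by omega)
    simp only [hδq]
    exact div_pos (by linarith) (mul_pos hℓpos hlogq)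
  set δ := (Finset.Icc 2 ℓ).inf' hne δq with hδ
  have hδpos : 0 < δ := (Finset.lt_inf'_iff hne).2 hδqpos
  refine ⟨δ, hδpos, fun H _ _ hexp ι _ s t u h => ?_⟩
  by_cases hH : Fintype.card H ≤ 1
  · exact htriv δ H hH ι s t u h
  have hH' : 1 < Nat.card H := by rw [Nat.card_eq_fintype_card]; omega
  obtain ⟨p, hp, r, κ, _, _, G', _, _, _, h2q, hqℓ, hcardle, ⟨e⟩⟩ :=
    exists_addEquiv_pi_zmod_prod ℓ H hexp hH'
  set q := p ^ r with hqdef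
  set n := Fintype.card κ with hn
  haveI : NeZero q := ⟨by omega⟩
  -- the counting bound
  have hb := h.card_le_of_addEquiv (p := p) r rfl e
  obtain ⟨hθ1, hθb⟩ := hθ q h2q
  have hLW := hθb κ
  -- cardinalities as reals
  have hHpos : (0 : ℝ) < Fintype.card H := by exact_mod_cast Fintype.card_pos
  have hH1 : (1 : ℝ) ≤ Fintype.card H := by exact_mod_cast Fintype.card_pos
  have hcardH : (Fintype.card H : ℝ) = (q : ℝ) ^ n * Fintype.card G' := by
    have := Fintype.card_congr e.toEquiv
    rw [Fintype.card_prod, Fintype.card_pi, Finset.prod_const, ZMod.card, card_univ] at this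
    rw [this]
    push_cast
    rfl
  have hq1 : (1 : ℝ) < q := by exact_mod_cast (show 1 < q by omega)
  have hlogq : 0 < Real.log q := Real.log_pos hq1
  have hℓpos : (0 : ℝ) < ℓ := by exact_mod_cast (show 0 < ℓ by omega)
  -- `θ^n ≤ |H|^{-δ_q}`
  have hθn : θ q ^ n ≤ (Fintype.card H : ℝ) ^ (-δq q) := by
    have hlogH : Real.log (Fintype.card H) ≤ n * ℓ * Real.log q := by
      have h1 : (Fintype.card H : ℝ) ≤ (q : ℝ) ^ (n * ℓ) := by
        rw [← Nat.card_eq_fintype_card]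
        exact_mod_cast hcardle
      have h2 := Real.log_le_log hHpos h1
      rwa [Real.log_pow, Nat.cast_mul, mul_assoc, ← mul_assoc] at h2
    rw [← Real.rpow_natCast (θ q) n, Real.rpow_def_of_pos (hθpos q),
      Real.rpow_def_of_pos hHpos, Real.exp_le_exp]
    have hrew : Real.log (Fintype.card H) * (-δq q) =
        Real.log (θ q) * (Real.log (Fintype.card H) / (ℓ * Real.log q)) := by
      simp only [hδq]
      field_simp
    rw [hrew]
    refine mul_le_mul_of_nonpos_left ?_ (Real.log_nonpos (hθpos q).le hθ1.le)
    rw [div_le_iff₀ (mul_pos hℓpos hlogq)]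
    linarith
  have hδle : (Fintype.card H : ℝ) ^ (-δq q) ≤ (Fintype.card H : ℝ) ^ (-δ) := by
    refine Real.rpow_le_rpow_of_exponent_le hH1 (neg_le_neg ?_)
    exact Finset.inf'_le _ (Finset.mem_Icc.2 ⟨h2q, hqℓ⟩)
  -- assemble
  have hθqn : 0 ≤ θ q ^ n := pow_nonneg (hθpos q).le _
  calc (Fintype.card ι : ℝ)
      ≤ 3 * Fintype.card (LowWeight q κ) * Fintype.card G' := by exact_mod_cast hb
    _ ≤ 3 * (θ q * q) ^ n * Fintype.card G' := by gcongr
    _ = 3 * θ q ^ n * (Fintype.card H : ℝ) := by rw [hcardH, mul_pow]; ring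
    _ ≤ 3 * (Fintype.card H : ℝ) ^ (-δ) * (Fintype.card H : ℝ) := by
        gcongr
        exact hθn.trans hδle
    _ = 3 * (Fintype.card H : ℝ) ^ (1 - δ) := by
        rw [sub_eq_neg_add, Real.rpow_add hHpos, Real.rpow_one]
        ring

end TheoremA

end Literature.Combinatorics.Additive
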